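import Summits.ABC.IUTFork.Joshi.AdelicAnsatzPeriodBridge
import Summits.ABC.IUTFork.Joshi.AdelicAnsatzPeriodScaling
import HarnessLib

/-!
# Joshi, ATS III §4: MERGE-DEBT RECONCILIATION T-07 ↔ T-08, part 2 — the valuation-level predicates
# (block E, file 4 of T-08 (part 2); sequel to `Joshi/AdelicAnsatzPeriodBridge.lean`)

Over T-07's `AdelicCurveDatum D` (`Joshi/AdelicAnsatz.lean`, [J-III] arXiv:2401.13508v4 §4.1–4.2) and the §4.4/§4.6 data
`ResidueFieldData` of part 1 (which builds T-08's `ArithPeriodDatum` with `ansatz := D.adelicAnsatz`), PROVES that T-08's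
hypothesis predicates of `Joshi/AdelicAnsatzPeriodScaling.lean` are T-07's objects:
* `diagonalOnL_of_mem` — (4.2.2.3) on `L′` for EVERY point of `Σ̃_{L′}`, from the diagonal clause of Def. 4.2.2 (T-07's
  UNCONDITIONAL `valuationConstantOffSS_holds` says the same on its evaluation domain);
* `scalingOnL_of_valuationScaling` — (4.2.2.2) on `L′` from T-07's claim-Prop `ValuationScaling` (Thm. 4.2.2.1 (4), derived
  by T-07 from [J-IIp] Thm. 6.9.1 as `valuationScaling_of`), read through the evaluation `L′ → T p_w` (`abs_emb`);
whence T-08's Thm. 4.6.1 (4) / Rmk. 4.6.2 (4) consequences transfer to T-07's Ansatz points under T-07's hypotheses: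
`alpha_scaling_of_valuationScaling` (`j² · α_{y_j,w} = α_{y_1,w}` on `V^{odd,ss}`) and `hyperplane_first_ne_of_valuationScaling`
(`H_{y_1} ≠ H_{y_j}`, a proved instance of Thm. 4.6.1 (6) "non-constant" along one Ansatz point). Kernel glue only; no Joshi
claim is asserted (T-07's `ValuationScaling` enters as a hypothesis); TAKES NO SIDE on [IUTchIII] Cor. 3.12 or on any author;
typed ≠ proved. No `Cor312*`/`Thm311*` import (E-PLAN R14). Standard axioms only; sorry-free. Seat abc-iut-E-t8 (LADDER-ABC:A2.E).
-/

noncomputable section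

open Set Filter

namespace Summit.ABC.IUTFork.Joshi

namespace AdelicCurveDatum

namespace ResidueFieldData

variable {D : AdelicCurveDatum} {L : Type} [Field L] (R : D.ResidueFieldData L)

/-- **(4.2.2.3) on `L′` — reconciled, UNCONDITIONAL**: every point of T-07's `Σ̃_{L′}` satisfies T-08's `DiagonalOnL`
(from T-07's `valuationConstantOffSS_holds`, equivalently from the diagonal clause). [folklore] -/
theorem diagonalOnL_of_mem {z : D.Tuple} (hz : z ∈ D.adelicAnsatz) : R.toArithPeriodDatum.DiagonalOnL z :=
  R.toArithPeriodDatum.diagonalOnL_of_isDiagonalOffBad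
    (R.toStandardPointData.isDiagonalOffBad_of_mem hz)

/-- **(4.2.2.2) on `L′` — reconciled**: under T-07's claim-Prop `ValuationScaling` (Thm. 4.2.2.1 (4)), every point of
`Σ̃_{L′}` satisfies T-08's `ScalingOnL` (read through `abs_emb`). Conditional on T-07's hypothesis; nothing asserted.
[folklore] -/
theorem scalingOnL_of_valuationScaling (hVS : D.ValuationScaling) {z : D.Tuple} (hz : z ∈ D.adelicAnsatz) :
    R.toArithPeriodDatum.ScalingOnL z := by
  intro w hw i x
  show R.abs w (z i w) (R.emb w (z i w) x) =
    R.abs w (z D.jOne w) (R.emb w (z D.jOne w) x) ^ (D.printedIndex i ^ 2)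
  rw [R.abs_emb, R.abs_emb]
  exact hVS z hz w hw i (R.evalL w x)

/-- **Rmk. 4.6.2 (4) for T-07's Ansatz points**: under `ValuationScaling` and standard normalization of `y_1`, `y_j`,
at `w ∈ V^{odd,ss}` with a non-unit of `L′`, `j² · α_{y_j,w} = α_{y_1,w}` (T-08's `alpha_scaling` composed with the
reconciliation). [folklore] -/
theorem alpha_scaling_of_valuationScaling (hVS : D.ValuationScaling) {z : D.Tuple} (hz : z ∈ D.adelicAnsatz)
    {i : Fin D.lstar} (h1 : R.toArithPeriodDatum.IsStdNormalized (z D.jOne))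
    (hj : R.toArithPeriodDatum.IsStdNormalized (z i)) {w : D.V} (hw : w ∈ D.oddss) {x : L} (hx0 : x ≠ 0)
    (hx1 : R.stdAbs w x ≠ 1) : ((D.printedIndex i : ℝ) ^ 2) * R.α (z i) w = R.α (z D.jOne) w :=
  R.toArithPeriodDatum.alpha_scaling (R.scalingOnL_of_valuationScaling hVS hz) h1 hj hw hx0 hx1

/-- **Thm. 4.6.1 (6) instance for T-07's Ansatz points**: under `ValuationScaling`, standard normalization, a place in
`V^{odd,ss}` and one outside it each carrying a non-unit of `L′`, the hyperplanes `H_{y_1} ≠ H_{y_j}` (`j ≥ 2`) of ONE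
point of `Σ̃_{L′}` differ (T-08's `hyperplane_first_ne` composed with the reconciliation). [folklore] -/
theorem hyperplane_first_ne_of_valuationScaling (hVS : D.ValuationScaling) {z : D.Tuple}
    (hz : z ∈ D.adelicAnsatz) {i : Fin D.lstar} (hi : i ≠ D.jOne)
    (h1 : R.toArithPeriodDatum.IsStdNormalized (z D.jOne)) (hj : R.toArithPeriodDatum.IsStdNormalized (z i))
    {w₀ w₁ : D.V} (hw₀ : w₀ ∈ D.oddss) (hw₁ : w₁ ∉ D.oddss)
    (hx₀ : ∃ x : L, x ≠ 0 ∧ R.stdAbs w₀ x ≠ 1) (hx₁ : ∃ x : L, x ≠ 0 ∧ R.stdAbs w₁ x ≠ 1) :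
    R.toArithPeriodDatum.hyperplane (z D.jOne) ≠ R.toArithPeriodDatum.hyperplane (z i) :=
  R.toArithPeriodDatum.hyperplane_first_ne (R.scalingOnL_of_valuationScaling hVS hz) (R.diagonalOnL_of_mem hz)
    hi h1 hj hw₀ hw₁ hx₀ hx₁

end ResidueFieldData

end AdelicCurveDatum

end Summit.ABC.IUTFork.Joshi
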